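import Literature.NumberTheory.Automorphic.Liu2021.LemD1Item3AtVNonsplitOfLineTransport
import Literature.NumberTheory.Automorphic.Liu2021.LemD1ItemAtV2IsoOfLineTransport
import Literature.RepresentationTheory.MoeglinVignerasWaldspurger1987.RankOneThetaLiftLinesDisjointOfIsotropic
import HarnessLib

/-!
# [Liu2021, Lem. D.1 (4)], `(ε, χ)`-clauses (→) at a NON-SPLIT place where `V` is ISOTROPIC, on the rank-`≥ 2` indexed family
# `localIndexedFamilyAtV₂ … v` — PROVED from the splitting-free disjointness of rank-one theta lifts (THEOREMS ONLY)

Topic `NumberTheory/Automorphic/Liu2021`; namespace `Literature.NumberTheory.Automorphic.Liu2021.Def411WeilCarriers` (home of ★ `localIndexedFamilyAtV₂`,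
★ `quotEquivLocalType₂`, ★ `areIsomorphicRep_localType₂_iff_quot`).  KERNEL ONLY: theorems (+ two private plumbing lemmas); no definition, no named
fact, no `sorry`, no instance, no notation.  Cell hodgecm-mathlib, FLOOR 0, half A line LD1 (socket `stub_S1_facts`, #73), LD1-p01 (g2);
`--supports stmt-HodgeConjecture-24832`.  Nothing of [Liu2021] is asserted.

THE POINT.  [Liu2021, App. D Lem. D.1 (4)] (p. 126, TeX l. 5235): «If `n = 2` and `ω(μ, ε, χ)` is nonzero, then `ω(μ′, ε′, χ′)` is isomorphic to
`ω(μ, ε, χ)` if and only if either `(μ′, ε′, χ′) = (μ, ε, χ)`, or `μ′ = μ^c χ̌`, `χ′ = χ`, and `ε′ = ε` (resp. `ε′ ≠ ε`) when `V` is isotropic (resp.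
anisotropic).»  At a non-split place where `V` is ISOTROPIC, BOTH alternatives of the «only if» give `ε′ ~ ε` and `χ′ = χ` — for EVERY pair of
Step-2 characters `μ, μ′`.  That `(ε, χ)`-statement is splitting-free, and the tree now PROVES it: ★ `rankOne_theta_lines_disjoint_of_isotropic`
(`MoeglinVignerasWaldspurger1987/RankOneThetaLiftLinesDisjointOfIsotropic.lean`, p849893: rank-one theta lifts to `U(V)(F_v)` from two lines of
different classes are disjoint when `V` has an isotropic vector, every rank, arbitrary splittings and characters) + ★
`rankOne_thetaChar_eq_of_areIsomorphicRep₂` (`χ`-clause, every rank) + [MoeglinVignerasWaldspurger1987, IV.2] PROVED ★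
`mvw_IV2_rankOne_nonvanishing_of_isotropic_holds` (at an isotropic `V` NO `ω(μ, ε, χ)` vanishes, so the printed «nonzero» proviso is automatic).
This file is the bookkeeping from the `(U(J_V), ι_{δ′})`-currency of those theorems to the currency of [Liu2021, §D.1] on the tree's rank-`≥ 2`
indexed family (★ `localIndexedFamilyAtV₂`, A-p15∕B-p13; member `t` = line `⟨a_t⟩`, character `χ_t`, ANY splitting family `𝓢_t` of the pair model
`gram e T_V (a_t)`, ANY Step-2 characters `μ_{t,•}`) — the rank-`≥ 2` twin of the rank-`3` chain ★ `LemD1Item3AtVOfSeparation` §2–§3 + ★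
`LemD1Item3AtVNonsplitOfLineTransport` §1 (fan A line `a4-liuD3`), whose proofs are reused here token for token with `3 ↦ N`, `hn : 2 ≤ n`:

* §1 `areIsomorphicRep_theta_comp_uEquiv_quot₂` — ONE MEMBER along a line-model transport `(s, M)`: `quot t ≅ Θ_s(χ_{t,v}) ∘ uEquiv` at every line
  `J₁` presenting the centre (★ `quotEquivLocalType₂` · ★ `ker_comp_localLineInl_eq` · ★ `TwistedCoinv.exists_equivariant_of_equivariant` · ★
  `LemD1OfPlace.ker_localCenter_eq_of_line`; the rank-`≥ 2` sibling of ★ `areIsomorphicRep_theta_comp_uEquiv_quot`, SAME PROOF);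
* §2 **`sameClass_and_chi_eq_of_areIsomorphicRep_nonsplit_of_isIsotropic_of_modelTransport`** — every rank `N ≥ 2`, `E_v` a field, `(E_vᴺ, J_V)`
  ISOTROPIC, line-model transports `(δ′_t, s_t, M_t)` for all members: `AreIsomorphicRep (quot j) (quot i) → LemD1.SameClass (eps i) (eps j) ∧
  chi j = chi i` — UNCONDITIONAL (no named fact enters; the rank-3 sibling was conditional on IV-4c1);
* §3 **`sameClass_and_chi_eq_of_areIsomorphicRep_nonsplit_of_isIsotropic_prodUnique`** — §2 at the reindexing `Equiv.prodUnique (Fin N) (Fin 1)`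
  with the tree's `e′_a` LINE-MODEL TRANSPORT (★ `lineTransportSection`, `δ′_t = a_t⁻¹ δ`, `M_t = 1`, ★ `omega_lineTransportSection_finLocalSplittings`);
* §4 `sameClass_and_chi_eq_of_areIsomorphicRep_localType₂_nonsplit_of_isIsotropic` — §3 read in the Θ-currency of the θ-package LOCAL FACTORS
  `Θ_v(t) = TwistedCoinv.rep (χ_{t,v}) ((𝓢_t).omegaLoc v) _ ∘ (k ↦ k ⊗ 1)` (★ (r1) `areIsomorphicRep_localType₂_iff_quot`) — the tokens of the
  LD letters R₂ ∕ L4 (`LemD1RankTwoCMLetters`), at `N = 2`: «`Θ_v(j) ≅ Θ_v(i)` at an isotropic non-split `v` ⟹ `a_j ~_v a_i` and `χ_j = χ_i`».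

WHAT IT PAYS.  At `N = 2`: the `ε`-clause (and `χ`-clause) of [Liu2021, Lem. D.1 (4)] «only if» at every non-split place where the plane `V_v` is
isotropic — all but the finitely many anisotropic `v` — for all labels and all splittings; in particular the LD letter R₂ (★
`LemD1_4SameLabelNonsplitCM₂`: same label, `Θ_v(λ,a,χ) ≅ Θ_v(λ,a′,χ) ≠ 0 ⇒ a ~_v a′`) at those places, once the consumer instantiates the family at its CM
package (`F = L⁺`, `E = L`, `δ = imagUnit`, `T_V = diag dV`, members `a, a′`, `𝓢` the `λ`-splitting package) and reads `SameClass` as `locF`-equality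
(★ `sameClass_epsLine_iff_locF_apply_eq`).  The ANISOTROPIC places are NOT covered (there the splitting-free statement is false; (P)∕torus road).

HONEST SCOPE.  Nothing of [Liu2021] is asserted; no book row moves by this file alone; HC_CM is proved only modulo the 7 printed citations
(2 remaining: hLiu418 = stmt-HodgeConjecture-24832, h413 = stmt-HodgeConjecture-24833) until rung 0 closes; count-neutral.

## References
* [Liu2021] Y. Liu, *Fourier–Jacobi cycles and arithmetic relative trace formula*, Camb. J. Math. 9 (2021) = arXiv:2102.11518 — App. D §D.1 Steps 1–3
  (l. 5213–5224), Lemma D.1 (4) (p. 126, l. 5235), proof l. 5257–5262.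
* [MoeglinVignerasWaldspurger1987] C. Mœglin, M.-F. Vignéras, J.-L. Waldspurger, LNM 1291 (1987), Chap. 2 II.1, Chap. 3 I.1–I.3, IV.2, IV.4.
* [HarrisKudlaSweet1996] M. Harris, S. Kudla, W. J. Sweet, J. AMS 9 (1996), Cor. 4.4 p. 962.
* [SunZhu2014] B. Sun, C.-B. Zhu, J. AMS 28 (2015), Thm. 1.10.
-/

set_option autoImplicit false

noncomputable section

open scoped Matrix Kronecker
open NumberField IsDedekindDomain
open Literature.NumberTheory.Automorphic Literature.NumberTheory.Automorphic.UnitaryGroup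
open Literature.RepresentationTheory
open Literature.RepresentationTheory.HeisenbergGroup (MpPsi)
open Literature.NumberTheory.GelbartRogawski1991 Literature.NumberTheory.GelbartRogawski1991.UnitaryDualPair
open Literature.NumberTheory.GelbartRogawski1991.UnitaryDualPair.WeilCoinv
open Literature.NumberTheory.GelbartRogawski1991.UnitaryDualPair.LocalSplitting
open Literature.RepresentationTheory.MoeglinVignerasWaldspurger1987

namespace Literature.NumberTheory.Automorphic.Liu2021.Def411WeilCarriers

variable (F E : Type) [Field F] [NumberField F] [Field E] [NumberField E] [Algebra F E]
variable (c : E ≃ₐ[F] E) (N : ℕ) {n : ℕ} (e : Fin N × Fin 1 ≃ Fin n)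
variable (JV : Matrix (Fin N) (Fin N) E) {TV : Matrix (Fin N) (Fin N) F}
variable [Algebra.IsQuadraticExtension F E] {δ : E} (hcδ : c δ = -δ) (hδ : δ ≠ 0) {d : F} (hd : δ * δ = algebraMap F E d)

omit [NumberField F] [NumberField E] [Algebra.IsQuadraticExtension F E] in
/-- `2 ≤ N` when `2 ≤ n` (`N = n` along `e`; plumbing, the family's own rank proof up to proof irrelevance). [folklore] -/
private theorem two_le_rank₂' (e : Fin N × Fin 1 ≃ Fin n) (hn : 2 ≤ n) : 2 ≤ N := by
  have := Fintype.card_congr e; simp only [Fintype.card_prod, Fintype.card_fin, mul_one] at this; omega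

omit [NumberField F] [NumberField E] [Algebra.IsQuadraticExtension F E] in
/-- in a commutative group with an endomorphism `σ`: `a = z · σ z · b ⟹ b = z⁻¹ · σ z⁻¹ · a` (plumbing for the class relation `SameClass`). [folklore] -/
private theorem eq_inv_mul_of_eq_mul₂ {G : Type*} [CommGroup G] (σ : G →* G) {a b z : G} (h : a = z * σ z * b) :
    b = z⁻¹ * σ z⁻¹ * a := by
  rw [h, map_inv, mul_comm z⁻¹ (σ z)⁻¹]
  group

omit [NumberField F] [NumberField E] [Algebra.IsQuadraticExtension F E] in
/-- in a commutative group with an endomorphism `σ`: if `eᵢ = x σx eⱼ`, `eᵢ = yᵢ σyᵢ Eᵢ`, `eⱼ = yⱼ σyⱼ Eⱼ` then `Eⱼ = w σw Eᵢ` with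
`w = (yᵢ⁻¹ x yⱼ)⁻¹` (plumbing for the class relation `SameClass`). [folklore] -/
private theorem sameClass_witness₂ {G : Type*} [CommGroup G] (σ : G →* G) {ei ej Ei Ej x yi yj : G}
    (hx : ei = x * σ x * ej) (hyi : ei = yi * σ yi * Ei) (hyj : ej = yj * σ yj * Ej) :
    Ej = (yi⁻¹ * x * yj)⁻¹ * σ (yi⁻¹ * x * yj)⁻¹ * Ei := by
  refine eq_inv_mul_of_eq_mul₂ σ ?_
  rw [eq_inv_mul_of_eq_mul₂ σ hyi, hx, hyj, map_mul, map_mul, map_inv]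
  simp only [mul_assoc, mul_comm, mul_left_comm]

/-! ## §1 One member of the rank-`≥ 2` family along a LINE-MODEL TRANSPORT: `quot t ≅ Θ_s(χ_{t,v}) ∘ uEquiv` -/

/-- **ONE MEMBER ALONG A LINE-MODEL TRANSPORT.**  Let member `t` of the indexed family of [Liu2021, App. D §D.1]'s data at `v`
(`localIndexedFamilyAtV … v`: line `⟨a_t⟩`, character `χ_t`, splitting family `𝓢_t` on the pair model
`LocalMp F n (gram e T_V (a_t)) v`, carrier `(𝓢_t).omegaLoc v ∘ (k ↦ k ⊗ 1) ∘ uEquiv`) be given together with a SECTION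
`s : U(J_V)(F_v) →* LocalMp F N T_V v` on the model of `V` itself and a linear equivalence `M : 𝒮(F_vᴺ) ≃ 𝒮(F_vⁿ)`
intertwining `ω_s = (MpPsi.toRep (localSchrodinger F N T_V v)).comp s` with `(𝓢_t).omegaLoc v ∘ (k ↦ k ⊗ 1)` (`hM`; for
`e = Equiv.prodUnique`, `gram = a_t • T_V` and `M = 1` — the `e′_a` model transport).  Then for EVERY hermitian line `J₁` the
member's `ω(μ_v, ε_v, χ_v)` (`quot t`, on `U(V)(F_v) = S.U`) is «isomorphic» (READING L7) to the rank-one theta lift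
`Θ_s(χ_{t,v})` of [MoeglinVignerasWaldspurger1987, Chap. 3 IV] in the currency of `RankOneThetaLift.lean` (coinvariants of
`ω_s` under the centre presented at `J₁`), read on `S.U` along `uEquiv`.  Chain: `quot t ≃ X_t ∘ uEquiv`
(`quotEquivLocalType`) · `X_t ≅` coinvariants of `(𝓢_t).omegaLoc v ∘ (k ↦ k ⊗ 1)` (same relation submodule,
`ker_comp_localLineInl_eq`) · `≅ Θ_s(χ_{t,v})` at the line `(a_t)` (along `M`, `TwistedCoinv.exists_equivariant_of_equivariant`)
· `≅ Θ_s(χ_{t,v})` at `J₁` (`ker_localCenter_eq_of_line`). [cite: Liu2021, App. D §D.1 Step 3 (l. 5221), Lemma D.1 (3) (l. 5233)]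
[cite: MoeglinVignerasWaldspurger1987, Chap. 2 II.1, Chap. 3 I.1–I.3] -/
theorem areIsomorphicRep_theta_comp_uEquiv_quot₂ (hV : TV.IsSymm) (hVd : IsUnit TV.det)
    (hJV : JV = TV.map (algebraMap F E))
    (hn : 2 ≤ n) {ι : Type} (aOf : ι → Fˣ) (χOf : ι → Chi F E c)
    (𝓢Of : ∀ i, LocalSplitting.FinLocalSplittings F E c n hcδ hδ hd (gram F e TV (TW F (aOf i))) (isSymm_gram F e hV (isSymm_TW F (aOf i)))
      (reindex_kronecker_eq_gram_map F E e hJV (JW_eq F E (aOf i))))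
    (μOf : ι → ∀ v : HeightOneSpectrum (𝓞 F), (LocalRing E v)ˣ →* ℂˣ) (hμn : ∀ i v x, ‖((μOf i v x : ℂˣ) : ℂ)‖ = 1)
    (hμc : ∀ i v, Continuous fun x => ((μOf i v x : ℂˣ) : ℂ))
    (hμF : ∀ (i : ι) (v : HeightOneSpectrum (𝓞 F)) (t : (v.adicCompletion F)ˣ),
      μOf i v (Units.map (algebraMap (v.adicCompletion F) (LocalRing E v)).toMonoidHom t) = 1 ↔
        ∃ x : (LocalRing E v)ˣ, (x : LocalRing E v) * conjLocal E c v x = algebraMap (v.adicCompletion F) (LocalRing E v) t)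
    (v : HeightOneSpectrum (𝓞 F)) (t : ι)
    (s : localPi E c N JV v →* LocalMp F N TV v)
    (M : SchwartzBruhat (Fin N → v.adicCompletion F) ≃ₗ[ℂ] SchwartzBruhat (Fin n → v.adicCompletion F))
    (hM : ∀ (g : localPi E c N JV v) (Φ : SchwartzBruhat (Fin N → v.adicCompletion F)),
      M (((MpPsi.toRep (localSchrodinger F N TV v)).comp s) g Φ) =
        (show Representation ℂ (localPi E c N JV v) (SchwartzBruhat (Fin n → v.adicCompletion F)) from
          ((𝓢Of t).omegaLoc v).comp (localLineInl E c N e JV (JW F E (aOf t)) v)) g (M Φ))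
    (J₁ : Matrix (Fin 1) (Fin 1) E) (hJ₁ : J₁ 0 0 ≠ 0) :
    AreIsomorphicRep
      (show Representation ℂ (localIndexedFamilyAtV₂ F E c N e JV hcδ hδ hd hV hVd hJV hn aOf χOf 𝓢Of μOf hμn hμc hμF v).S.U _ from
        (TwistedCoinv.rep
          (ρW := show Representation ℂ (localPi E c 1 J₁ v) (SchwartzBruhat (Fin N → v.adicCompletion F)) from
            ((MpPsi.toRep (localSchrodinger F N TV v)).comp s).comp (localCenter E c N JV J₁ hJ₁ v))
          (localCharOfCenter F E c J₁ hJ₁ (χOf t).1 v) ((MpPsi.toRep (localSchrodinger F N TV v)).comp s)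
          (fun g z => (show Commute g (localCenter E c N JV J₁ hJ₁ v z) from
            localCenter_comm E c N JV J₁ hJ₁ v z g).map ((MpPsi.toRep (localSchrodinger F N TV v)).comp s))).comp
        (LemD1OfPlace.uEquiv E v c N JV hcδ hδ (two_le_rank₂' N e hn) (transpose_map_conj_JV F E c N JV hV hJV)
          (det_JV_ne_zero F E N JV hVd hJV)).toMulEquiv.toMonoidHom)
      ((localIndexedFamilyAtV₂ F E c N e JV hcδ hδ hd hV hVd hJV hn aOf χOf 𝓢Of μOf hμn hμc hμF v).quot t) := by
  -- (1) the as-printed quotient is the local type `X_t` read along `uEquiv`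
  have h1 := areIsomorphicRep_of_equiv
    (quotEquivLocalType₂ F E c N e JV hcδ hδ hd hV hVd hJV (aOf t) (𝓢Of t) hn (μOf t) (hμn t) (hμc t) (hμF t) (χOf t) v)
  -- (2) `X_t ≅` the coinvariants of `(𝓢_t).omegaLoc v ∘ (k ↦ k ⊗ 1)` under the centre of `U(J_V)` at the line `(a_t)`
  have h2 : AreIsomorphicRep
      (show Representation ℂ (localPi E c N JV v) _ from
        (TwistedCoinv.rep (localCharOfCenter F E c (JW F E (aOf t)) (JW_apply_ne_zero F E (aOf t)) (χOf t).1 v) ((𝓢Of t).omegaLoc v)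
          (commute_omegaLoc_localCenter F E c N e JV (JW F E (aOf t)) hcδ hδ hd hV (isSymm_TW F (aOf t)) hJV (JW_eq F E (aOf t))
            (JW_apply_ne_zero F E (aOf t)) (𝓢Of t) v)).comp (localLineInl E c N e JV (JW F E (aOf t)) v))
      (TwistedCoinv.rep
        (ρW := show Representation ℂ (localPi E c 1 (JW F E (aOf t)) v) (SchwartzBruhat (Fin n → v.adicCompletion F)) from
          (show Representation ℂ (localPi E c N JV v) (SchwartzBruhat (Fin n → v.adicCompletion F)) from
            ((𝓢Of t).omegaLoc v).comp (localLineInl E c N e JV (JW F E (aOf t)) v)).comp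
            (localCenter E c N JV (JW F E (aOf t)) (JW_apply_ne_zero F E (aOf t)) v))
        (localCharOfCenter F E c (JW F E (aOf t)) (JW_apply_ne_zero F E (aOf t)) (χOf t).1 v)
        (show Representation ℂ (localPi E c N JV v) (SchwartzBruhat (Fin n → v.adicCompletion F)) from
          ((𝓢Of t).omegaLoc v).comp (localLineInl E c N e JV (JW F E (aOf t)) v))
        (fun g z => (show Commute g (localCenter E c N JV (JW F E (aOf t)) (JW_apply_ne_zero F E (aOf t)) v z) from
          localCenter_comm E c N JV (JW F E (aOf t)) (JW_apply_ne_zero F E (aOf t)) v z g).map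
            (show Representation ℂ (localPi E c N JV v) (SchwartzBruhat (Fin n → v.adicCompletion F)) from
              ((𝓢Of t).omegaLoc v).comp (localLineInl E c N e JV (JW F E (aOf t)) v)))) :=
    areIsomorphicRep_coinv_of_ker_eq (ker_comp_localLineInl_eq F E c N e JV hcδ hδ hd hV hJV (aOf t) (𝓢Of t) (χOf t) v).symm _ _
      (fun g => (𝓢Of t).omegaLoc v (localLineInl E c N e JV (JW F E (aOf t)) v g)) (fun _ _ => rfl) (fun _ _ => rfl)
  -- (3) along `M`: `Θ_s(χ_{t,v})` at the line `(a_t)` `≅` those coinvariants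
  have h3 := TwistedCoinv.exists_equivariant_of_equivariant ((MpPsi.toRep (localSchrodinger F N TV v)).comp s)
    (show Representation ℂ (localPi E c N JV v) (SchwartzBruhat (Fin n → v.adicCompletion F)) from
      ((𝓢Of t).omegaLoc v).comp (localLineInl E c N e JV (JW F E (aOf t)) v))
    (localCenter E c N JV (JW F E (aOf t)) (JW_apply_ne_zero F E (aOf t)) v)
    (localCharOfCenter F E c (JW F E (aOf t)) (JW_apply_ne_zero F E (aOf t)) (χOf t).1 v)
    (fun g z => (show Commute g (localCenter E c N JV (JW F E (aOf t)) (JW_apply_ne_zero F E (aOf t)) v z) from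
      localCenter_comm E c N JV (JW F E (aOf t)) (JW_apply_ne_zero F E (aOf t)) v z g).map
        ((MpPsi.toRep (localSchrodinger F N TV v)).comp s))
    (fun g z => (show Commute g (localCenter E c N JV (JW F E (aOf t)) (JW_apply_ne_zero F E (aOf t)) v z) from
      localCenter_comm E c N JV (JW F E (aOf t)) (JW_apply_ne_zero F E (aOf t)) v z g).map
        (show Representation ℂ (localPi E c N JV v) (SchwartzBruhat (Fin n → v.adicCompletion F)) from
          ((𝓢Of t).omegaLoc v).comp (localLineInl E c N e JV (JW F E (aOf t)) v)))
    M hM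
  -- (4) change of the line presenting the centre: `(a_t)` ↦ `J₁`
  have h4 : AreIsomorphicRep
      (TwistedCoinv.rep
        (ρW := show Representation ℂ (localPi E c 1 J₁ v) (SchwartzBruhat (Fin N → v.adicCompletion F)) from
          ((MpPsi.toRep (localSchrodinger F N TV v)).comp s).comp (localCenter E c N JV J₁ hJ₁ v))
        (localCharOfCenter F E c J₁ hJ₁ (χOf t).1 v) ((MpPsi.toRep (localSchrodinger F N TV v)).comp s)
        (fun g z => (show Commute g (localCenter E c N JV J₁ hJ₁ v z) from
          localCenter_comm E c N JV J₁ hJ₁ v z g).map ((MpPsi.toRep (localSchrodinger F N TV v)).comp s)))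
      (TwistedCoinv.rep
        (ρW := show Representation ℂ (localPi E c 1 (JW F E (aOf t)) v) (SchwartzBruhat (Fin N → v.adicCompletion F)) from
          ((MpPsi.toRep (localSchrodinger F N TV v)).comp s).comp
            (localCenter E c N JV (JW F E (aOf t)) (JW_apply_ne_zero F E (aOf t)) v))
        (localCharOfCenter F E c (JW F E (aOf t)) (JW_apply_ne_zero F E (aOf t)) (χOf t).1 v)
        ((MpPsi.toRep (localSchrodinger F N TV v)).comp s)
        (fun g z => (show Commute g (localCenter E c N JV (JW F E (aOf t)) (JW_apply_ne_zero F E (aOf t)) v z) from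
          localCenter_comm E c N JV (JW F E (aOf t)) (JW_apply_ne_zero F E (aOf t)) v z g).map
            ((MpPsi.toRep (localSchrodinger F N TV v)).comp s))) :=
    areIsomorphicRep_coinv_of_ker_eq
      (LemD1OfPlace.ker_localCenter_eq_of_line E v c N JV hcδ hδ (two_le_rank₂' N e hn) (transpose_map_conj_JV F E c N JV hV hJV)
        (det_JV_ne_zero F E N JV hVd hJV) ((MpPsi.toRep (localSchrodinger F N TV v)).comp s) (χOf t).1 J₁ (JW F E (aOf t)) hJ₁
        (JW_apply_ne_zero F E (aOf t))) _ _
      (fun g => ((MpPsi.toRep (localSchrodinger F N TV v)).comp s) g) (fun _ _ => rfl) (fun _ _ => rfl)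
  -- compose: `Θ_s(χ)_{J₁} ≅ Θ_s(χ)_{(a_t)} ≅ Coinv(ω_t ∘ inl) ≅ X_t`, then read on `S.U` along `uEquiv`
  exact (((h4.trans h3).trans h2.symm).comp _).trans h1.symm


/-! ## §3 [Lem. D.1 (3)] AS PRINTED on `localIndexedFamilyAtV … v`, `(ε, χ)`-clauses (→), `N = 3`, NON-SPLIT `v` — from the
separation of rank-one theta lifts (`rankOne_theta_sameClass_and_char_eq_of_areIsomorphicRep`, conditional on row IV-4c1) -/


/-! ## §2 [Lem. D.1 (4)], `(ε, χ)`-clauses (→) at a NON-SPLIT place with `V` ISOTROPIC, every rank `N ≥ 2`, through line-model transports —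
UNCONDITIONAL -/

/-- **[Liu2021, App. D Lem. D.1 (4)], `(ε, χ)`-CLAUSES (→ direction) AT A NON-SPLIT PLACE WHERE `V` IS ISOTROPIC, on the rank-`≥ 2` indexed
family `localIndexedFamilyAtV₂ … v`, THROUGH LINE-MODEL TRANSPORTS — PROVED, no named fact.**  Hypotheses: `E_v` a field (`hE`); the hermitian
space `(E_vᴺ, J_V)` of the family's standing data is ISOTROPIC (`hiso`); for every member `t`, a trace-zero `δ'_t` (`δ'_t² = d'_t`) whose representative
`δ'_t ⊗ 1` lies in the class of the member's `ε_{t,v} = (a_t δ) ⊗ 1` (`hy`), a SECTION `s_t : U(J_V)(F_v) →* LocalMp F N T_V v` over `ι_{δ'_t}` (`hs`)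
with `ω_{s_t}` smooth (`hsm`) and a linear equivalence `M_t : 𝒮(F_vᴺ) ≃ 𝒮(F_vⁿ)` intertwining `ω_{s_t}` with `(𝓢_t).omegaLoc v ∘ (k ↦ k ⊗ 1)` (`hM`).
THEN «`ω(μ_j, ε_j, χ_j) ≅ ω(μ_i, ε_i, χ_i)`» (`AreIsomorphicRep (quot j) (quot i)`, READING L7) forces `ε_i`, `ε_j` into ONE class of `E_v^{−×}/Nm E_vˣ`
(`LemD1.SameClass (eps i) (eps j)`) AND `χ_j = χ_i` (`chi j = chi i`) — for EVERY pair of Step-2 characters `μ_i, μ_j` and every pair of splitting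
families.  Proof: §1 for `i` and `j` puts both members in the `(U(J_V), ι_{δ′})`-currency; `Θ_{s_j}(χ_j) ≠ 0` is [MoeglinVignerasWaldspurger1987,
Chap. 3 IV.2] PROVED (★ `mvw_IV2_rankOne_nonvanishing_of_isotropic_holds`) at the isotropic space; the `ε`-clause is the splitting-free
disjointness ★ `rankOne_theta_lines_disjoint_of_isotropic` (by contradiction), the `χ`-clause ★ `rankOne_thetaChar_eq_of_areIsomorphicRep₂`; the classes
of `δ'_t ⊗ 1` and `(a_t δ) ⊗ 1` agree by `hy`, the characters at `S.normOne` by ★ `localCharOfCenter_theta_eq`.  (Rank-`≥ 2` sibling of the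
rank-`3` ★ `sameClass_and_chi_eq_of_areIsomorphicRep_nonsplit_of_modelTransport`, which is conditional on IV-4c1.)
[cite: Liu2021, App. D Lemma D.1 (4) (p. 126, l. 5235), proof l. 5257–5262] [cite: MoeglinVignerasWaldspurger1987, Chap. 3 IV.2, IV.4]
[cite: HarrisKudlaSweet1996, Cor. 4.4 p. 962] -/
theorem sameClass_and_chi_eq_of_areIsomorphicRep_nonsplit_of_isIsotropic_of_modelTransport
    (hV : TV.IsSymm) (hVd : IsUnit TV.det) (hJV : JV = TV.map (algebraMap F E))
    (hn : 2 ≤ n) {ι : Type} (aOf : ι → Fˣ) (χOf : ι → Chi F E c)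
    (𝓢Of : ∀ i, LocalSplitting.FinLocalSplittings F E c n hcδ hδ hd (gram F e TV (TW F (aOf i))) (isSymm_gram F e hV (isSymm_TW F (aOf i)))
      (reindex_kronecker_eq_gram_map F E e hJV (JW_eq F E (aOf i))))
    (μOf : ι → ∀ v : HeightOneSpectrum (𝓞 F), (LocalRing E v)ˣ →* ℂˣ) (hμn : ∀ i v x, ‖((μOf i v x : ℂˣ) : ℂ)‖ = 1)
    (hμc : ∀ i v, Continuous fun x => ((μOf i v x : ℂˣ) : ℂ))
    (hμF : ∀ (i : ι) (v : HeightOneSpectrum (𝓞 F)) (t : (v.adicCompletion F)ˣ),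
      μOf i v (Units.map (algebraMap (v.adicCompletion F) (LocalRing E v)).toMonoidHom t) = 1 ↔
        ∃ x : (LocalRing E v)ˣ, (x : LocalRing E v) * conjLocal E c v x = algebraMap (v.adicCompletion F) (LocalRing E v) t)
    (v : HeightOneSpectrum (𝓞 F)) (hE : IsField (LocalRing E v))
    (hiso : LemD1.IsIsotropic (localIndexedFamilyAtV₂ F E c N e JV hcδ hδ hd hV hVd hJV hn aOf χOf 𝓢Of μOf hμn hμc hμF v).S)
    (i j : ι)
    (δ' : ι → E) (hcδ' : ∀ t, c (δ' t) = -δ' t) (hδ' : ∀ t, δ' t ≠ 0) (d' : ι → F)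
    (hd' : ∀ t, δ' t * δ' t = algebraMap F E (d' t))
    (hy : ∀ t, ∃ y : (LocalRing E v)ˣ, LemD1OfPlace.eps E v (hδ' t) =
      y * Units.map (conjLocal E c v : LocalRing E v →* LocalRing E v) y * epsLine E hδ (aOf t) v)
    (s : ι → (localPi E c N JV v →* LocalMp F N TV v))
    (hs : ∀ t g, MpPsi.proj _ (s t g) = iota F E c N (hcδ' t) (hδ' t) (hd' t) TV hV hJV v g)
    (hsm : ∀ t, Representation.IsSmooth ((MpPsi.toRep (localSchrodinger F N TV v)).comp (s t)))
    (M : ι → (SchwartzBruhat (Fin N → v.adicCompletion F) ≃ₗ[ℂ] SchwartzBruhat (Fin n → v.adicCompletion F)))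
    (hM : ∀ (t : ι) (g : localPi E c N JV v) (Φ : SchwartzBruhat (Fin N → v.adicCompletion F)),
      M t (((MpPsi.toRep (localSchrodinger F N TV v)).comp (s t)) g Φ) =
        (show Representation ℂ (localPi E c N JV v) (SchwartzBruhat (Fin n → v.adicCompletion F)) from
          ((𝓢Of t).omegaLoc v).comp (localLineInl E c N e JV (JW F E (aOf t)) v)) g (M t Φ))
    (hiso' : AreIsomorphicRep
      ((localIndexedFamilyAtV₂ F E c N e JV hcδ hδ hd hV hVd hJV hn aOf χOf 𝓢Of μOf hμn hμc hμF v).quot j)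
      ((localIndexedFamilyAtV₂ F E c N e JV hcδ hδ hd hV hVd hJV hn aOf χOf 𝓢Of μOf hμn hμc hμF v).quot i)) :
    LemD1.SameClass ((localIndexedFamilyAtV₂ F E c N e JV hcδ hδ hd hV hVd hJV hn aOf χOf 𝓢Of μOf hμn hμc hμF v).eps i)
        ((localIndexedFamilyAtV₂ F E c N e JV hcδ hδ hd hV hVd hJV hn aOf χOf 𝓢Of μOf hμn hμc hμF v).eps j) ∧
      (localIndexedFamilyAtV₂ F E c N e JV hcδ hδ hd hV hVd hJV hn aOf χOf 𝓢Of μOf hμn hμc hμF v).chi j =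
        (localIndexedFamilyAtV₂ F E c N e JV hcδ hδ hd hV hVd hJV hn aOf χOf 𝓢Of μOf hμn hμc hμF v).chi i := by
  have hN : 2 ≤ N := two_le_rank₂' N e hn
  have hJh : (JV.map c)ᵀ = JV := transpose_map_conj_JV F E c N JV hV hJV
  have hJdet : JV.det ≠ 0 := det_JV_ne_zero F E N JV hVd hJV
  -- unitarity and continuity of the local components `χ_{t,v}` at the line `(a_j)`
  have hχu : ∀ t z, ‖((localCharOfCenter F E c (JW F E (aOf j)) (JW_apply_ne_zero F E (aOf j)) (χOf t).1 v z : ℂˣ) : ℂ)‖ = 1 :=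
    fun t => norm_localCharOfCenter F E c (JW F E (aOf j)) (JW_apply_ne_zero F E (aOf j))
      (norm_chi_eq_one F E c (Algebra.IsQuadraticExtension.finrank_eq_two F E)
        (UnitaryGroup.algEquiv_ne_one_of_apply_eq_neg F E c hcδ hδ) (χOf t)) v
  have hχc : ∀ t, Continuous fun z => ((localCharOfCenter F E c (JW F E (aOf j)) (JW_apply_ne_zero F E (aOf j)) (χOf t).1 v z : ℂˣ) : ℂ) :=
    fun t => continuous_coe_localCharOfCenter F E c (JW F E (aOf j)) (JW_apply_ne_zero F E (aOf j)) (χOf t).2.1 v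
  -- (a) both members in the `(U(J_V), ι_{δ′})`-currency (§1), at the common line `(a_j)`
  have hj := areIsomorphicRep_theta_comp_uEquiv_quot₂ F E c N e JV hcδ hδ hd hV hVd hJV hn aOf χOf 𝓢Of μOf hμn hμc hμF v j
    (s j) (M j) (hM j) (JW F E (aOf j)) (JW_apply_ne_zero F E (aOf j))
  have hi := areIsomorphicRep_theta_comp_uEquiv_quot₂ F E c N e JV hcδ hδ hd hV hVd hJV hn aOf χOf 𝓢Of μOf hμn hμc hμF v i
    (s i) (M i) (hM i) (JW F E (aOf j)) (JW_apply_ne_zero F E (aOf j))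
  have hisoY := AreIsomorphicRep.of_comp_surjective _
    (LemD1OfPlace.uEquiv E v c N JV hcδ hδ (two_le_rank₂' N e hn) hJh hJdet).surjective ((hj.trans hiso').trans hi.symm)
  -- (b) the isotropic vector of `(E_vᴺ, J_V)`, in the coordinates of the local Gram matrix
  obtain ⟨r, hr0, hr⟩ := hiso
  have hr' : hermForm (conjLocal E c v) ((adelicForm E N JV).map (adeleToLocal E v)) r r = 0 := hr
  -- (c) `Θ_{s_j}(χ_j) ≠ 0`: MVW IV.2 (proved) at the isotropic space
  have hnt := mvw_IV2_rankOne_nonvanishing_of_isotropic_holds F E c N (δ' j) (hcδ' j) (hδ' j) (d' j) (hd' j) TV hV hVd JV hJV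
    v hE hN hJh hJdet ⟨r, hr0, hr'⟩ (s j) (hs j) (hsm j) (JW F E (aOf j)) (JW_apply_ne_zero F E (aOf j))
    (localCharOfCenter F E c (JW F E (aOf j)) (JW_apply_ne_zero F E (aOf j)) (χOf j).1 v) (hχu j) (hχc j)
  -- (d) the `ε`-clause: the splitting-free disjointness of the two lines' theta lifts at the isotropic `V`, by contradiction
  have hε : ∃ x : (LocalRing E v)ˣ, LemD1OfPlace.eps E v (hδ' i) =
      x * Units.map (conjLocal E c v : LocalRing E v →* LocalRing E v) x * LemD1OfPlace.eps E v (hδ' j) := by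
    by_contra hcls
    exact rankOne_theta_lines_disjoint_of_isotropic F E c hN (δ' j) (hcδ' j) (hδ' j) (d' j) (hd' j) (δ' i) (hcδ' i) (hδ' i)
      (d' i) (hd' i) TV hV hVd JV hJV v hE hcls ⟨r, hr0, hr'⟩ (s j) (s i) (hs j) (hs i) (hsm j) (hsm i)
      (JW F E (aOf j)) (JW_apply_ne_zero F E (aOf j))
      (localCharOfCenter F E c (JW F E (aOf j)) (JW_apply_ne_zero F E (aOf j)) (χOf j).1 v)
      (localCharOfCenter F E c (JW F E (aOf j)) (JW_apply_ne_zero F E (aOf j)) (χOf i).1 v)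
      (hχu j) (hχc j) (hχu i) (hχc i) hnt hisoY
  -- (e) the `χ`-clause: the centre acts by the character on a non-zero theta lift
  have hχ := rankOne_thetaChar_eq_of_areIsomorphicRep₂ F E c N TV JV v (s j) (s i) (JW F E (aOf j)) (JW_apply_ne_zero F E (aOf j))
    (localCharOfCenter F E c (JW F E (aOf j)) (JW_apply_ne_zero F E (aOf j)) (χOf j).1 v)
    (localCharOfCenter F E c (JW F E (aOf j)) (JW_apply_ne_zero F E (aOf j)) (χOf i).1 v) hnt hisoY
  refine ⟨?_, ?_⟩
  · -- (ε) `δ'_i ⊗ 1 = x xᶜ (δ'_j ⊗ 1)` and `δ'_t ⊗ 1 = y_t y_tᶜ ((a_t δ) ⊗ 1)` ⟹ `(a_j δ) ⊗ 1 = w wᶜ ((a_i δ) ⊗ 1)`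
    obtain ⟨x, hx⟩ := hε
    obtain ⟨yi, hyi⟩ := hy i
    obtain ⟨yj, hyj⟩ := hy j
    exact (sameClass_eps_localIndexedFamilyAtV₂_iff F E c N JV hcδ hδ hd e hV hVd hJV hn aOf χOf 𝓢Of μOf hμn hμc hμF v i j).2
      ⟨(yi⁻¹ * x * yj)⁻¹, sameClass_witness₂ (Units.map (conjLocal E c v : LocalRing E v →* LocalRing E v)) hx hyi hyj⟩
  · -- (χ) `χ_{j,v} = χ_{i,v}` at the line `(a_j)` ⟹ `χ_j ∘ θ_{(a_j)} = χ_i ∘ θ_{(a_i)}` on `E_v¹`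
    refine Subtype.ext (MonoidHom.ext fun z => ?_)
    change localCharOfCenter F E c (JW F E (aOf j)) (JW_apply_ne_zero F E (aOf j)) (χOf j).1 v
        (LemD1OfPlace.theta E v c N JV hcδ hδ _ _ _ (JW F E (aOf j)) z) =
      localCharOfCenter F E c (JW F E (aOf i)) (JW_apply_ne_zero F E (aOf i)) (χOf i).1 v
        (LemD1OfPlace.theta E v c N JV hcδ hδ _ _ _ (JW F E (aOf i)) z)
    rw [hχ, localCharOfCenter_theta_eq F E c N JV hcδ hδ _ _ _ v (JW F E (aOf j)) (JW F E (aOf i))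
      (JW_apply_ne_zero F E (aOf j)) (JW_apply_ne_zero F E (aOf i)) (χOf i).1 z]

/-! ## §3 The same at the reindexing `Equiv.prodUnique (Fin N) (Fin 1)` with the `e′_a` line-model transport (`M_t = 1`) -/

/-- **[Liu2021, App. D Lem. D.1 (4)], `(ε, χ)`-CLAUSES (→) AT A NON-SPLIT PLACE WHERE `V` IS ISOTROPIC, on the rank-`≥ 2` indexed family at the
reindexing `Equiv.prodUnique (Fin N) (Fin 1)` — PROVED, no named fact**: for `E_v` a field, `(E_vᴺ, J_V)` isotropic and members `i, j` of
`localIndexedFamilyAtV₂ F E c N (Equiv.prodUnique (Fin N) (Fin 1)) J_V … v` (lines `⟨a_t⟩`, characters `χ_t`, ANY splitting families `𝓢_t` of the pair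
models `a_t • T_V`, ANY Step-2 characters `μ_{t,•}`), «`ω(μ_j, ε_j, χ_j) ≅ ω(μ_i, ε_i, χ_i)`» (`AreIsomorphicRep (quot j) (quot i)`) ⟹
`LemD1.SameClass (eps i) (eps j) ∧ chi j = chi i`.  §2 at the `e′_a` transport of ★ `LocalLineModelTransport` (`δ'_t = a_t⁻¹ δ`, `s_t =
lineTransportSection …`, `M_t = 1`, ★ `omega_lineTransportSection_finLocalSplittings`, class witness ★ `epsLine_eq_mul_conj_mul_eps_lineDelta`); the
rank-`≥ 2` unconditional sibling of ★ `sameClass_and_chi_eq_of_areIsomorphicRep_nonsplit_prodUnique`.  At `N = 2`: the «only if» of [Lem. D.1 (4)]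
at an isotropic plane, `(ε, χ)`-part, all labels, all splittings. [cite: Liu2021, App. D Lemma D.1 (4) (p. 126, l. 5235), proof l. 5257–5262]
[cite: MoeglinVignerasWaldspurger1987, Chap. 2 II.1, Chap. 3 IV.2, IV.4] [cite: HarrisKudlaSweet1996, Cor. 4.4 p. 962] -/
theorem sameClass_and_chi_eq_of_areIsomorphicRep_nonsplit_of_isIsotropic_prodUnique
    (hV : TV.IsSymm) (hVd : IsUnit TV.det) (hJV : JV = TV.map (algebraMap F E)) (hN : 2 ≤ N)
    {ι : Type} (aOf : ι → Fˣ) (χOf : ι → Chi F E c)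
    (𝓢Of : ∀ i, LocalSplitting.FinLocalSplittings F E c N hcδ hδ hd (gram F (Equiv.prodUnique (Fin N) (Fin 1)) TV (TW F (aOf i)))
      (isSymm_gram F (Equiv.prodUnique (Fin N) (Fin 1)) hV (isSymm_TW F (aOf i)))
      (reindex_kronecker_eq_gram_map F E (Equiv.prodUnique (Fin N) (Fin 1)) hJV (JW_eq F E (aOf i))))
    (μOf : ι → ∀ v : HeightOneSpectrum (𝓞 F), (LocalRing E v)ˣ →* ℂˣ) (hμn : ∀ i v x, ‖((μOf i v x : ℂˣ) : ℂ)‖ = 1)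
    (hμc : ∀ i v, Continuous fun x => ((μOf i v x : ℂˣ) : ℂ))
    (hμF : ∀ (i : ι) (v : HeightOneSpectrum (𝓞 F)) (t : (v.adicCompletion F)ˣ),
      μOf i v (Units.map (algebraMap (v.adicCompletion F) (LocalRing E v)).toMonoidHom t) = 1 ↔
        ∃ x : (LocalRing E v)ˣ, (x : LocalRing E v) * conjLocal E c v x = algebraMap (v.adicCompletion F) (LocalRing E v) t)
    (v : HeightOneSpectrum (𝓞 F)) (hE : IsField (LocalRing E v))
    (hiso : LemD1.IsIsotropic (localIndexedFamilyAtV₂ F E c N (Equiv.prodUnique (Fin N) (Fin 1)) JV hcδ hδ hd hV hVd hJV hN aOf χOf 𝓢Of μOf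
      hμn hμc hμF v).S)
    (i j : ι)
    (hiso' : AreIsomorphicRep
      ((localIndexedFamilyAtV₂ F E c N (Equiv.prodUnique (Fin N) (Fin 1)) JV hcδ hδ hd hV hVd hJV hN aOf χOf 𝓢Of μOf hμn hμc hμF v).quot j)
      ((localIndexedFamilyAtV₂ F E c N (Equiv.prodUnique (Fin N) (Fin 1)) JV hcδ hδ hd hV hVd hJV hN aOf χOf 𝓢Of μOf hμn hμc hμF v).quot i)) :
    LemD1.SameClass
        ((localIndexedFamilyAtV₂ F E c N (Equiv.prodUnique (Fin N) (Fin 1)) JV hcδ hδ hd hV hVd hJV hN aOf χOf 𝓢Of μOf hμn hμc hμF v).eps i)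
        ((localIndexedFamilyAtV₂ F E c N (Equiv.prodUnique (Fin N) (Fin 1)) JV hcδ hδ hd hV hVd hJV hN aOf χOf 𝓢Of μOf hμn hμc hμF v).eps j) ∧
      (localIndexedFamilyAtV₂ F E c N (Equiv.prodUnique (Fin N) (Fin 1)) JV hcδ hδ hd hV hVd hJV hN aOf χOf 𝓢Of μOf hμn hμc hμF v).chi j =
        (localIndexedFamilyAtV₂ F E c N (Equiv.prodUnique (Fin N) (Fin 1)) JV hcδ hδ hd hV hVd hJV hN aOf χOf 𝓢Of μOf hμn hμc hμF v).chi i :=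
  sameClass_and_chi_eq_of_areIsomorphicRep_nonsplit_of_isIsotropic_of_modelTransport F E c N (Equiv.prodUnique (Fin N) (Fin 1)) JV hcδ hδ
    hd hV hVd hJV hN aOf χOf 𝓢Of μOf hμn hμc hμF v hE hiso i j
    (fun t => algebraMap F E (↑(aOf t)⁻¹ : F) * δ) (fun t => conj_lineDelta hcδ (aOf t)) (fun t => lineDelta_ne_zero hδ (aOf t))
    (fun t => ↑(aOf t)⁻¹ * ↑(aOf t)⁻¹ * d) (fun t => lineDelta_mul_self hd (aOf t))
    (fun t => ⟨_, eq_inv_mul_of_eq_mul₂ (Units.map (conjLocal E c v : LocalRing E v →* LocalRing E v))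
      (epsLine_eq_mul_conj_mul_eps_lineDelta F E c (aOf t) v (hδ := hδ))⟩)
    (fun t => lineTransportSection F E c N hcδ hδ hd TV hV JV hJV (aOf t) v ((𝓢Of t).s v) ((𝓢Of t).proj_s v))
    (fun t g => proj_lineTransportSection F E c N hcδ hδ hd TV hV JV hJV (aOf t) v ((𝓢Of t).s v) ((𝓢Of t).proj_s v) g)
    (fun t => isSmooth_lineTransportSection F E c N hcδ hδ hd TV hV JV hJV (aOf t) v ((𝓢Of t).s v) ((𝓢Of t).proj_s v) ((𝓢Of t).smooth v))
    (fun _ => LinearEquiv.refl ℂ _)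
    (fun t g Φ => LinearMap.congr_fun
      (DFunLike.congr_fun (omega_lineTransportSection_finLocalSplittings F E c N hcδ hδ hd TV hV JV hJV (aOf t) v (𝓢Of t)) g) Φ)
    hiso'

/-! ## §4 The same read in the Θ-currency of the θ-package local factors (the tokens of the LD letters R₂ ∕ L4) -/

/-- **THE `(ε, χ)`-CLAUSES IN THE Θ-CURRENCY — the tokens of the letters R₂ ∕ L4 of `LemD1RankTwoCMLetters`**: for `E_v` a field, `(E_vᴺ, J_V)`
ISOTROPIC and members `i, j` of the rank-`≥ 2` θ-package family at `v` (reindexing `Equiv.prodUnique (Fin N) (Fin 1)`; any lines `a_t`, any `χ_t`,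
ANY splitting families `𝓢_t`, ANY Step-2 characters), if the θ-package LOCAL FACTORS satisfy **`Θ_v(j) ≅ Θ_v(i)`** as representations of `U(J_V)(F_v)`
(`Θ_v(t) = TwistedCoinv.rep (χ_{t,v}) ((𝓢_t).omegaLoc v) _ ∘ (k ↦ k ⊗ 1)`, `AreIsomorphicRep`), then the lines are in ONE class at `v`
(`LemD1.SameClass (eps i) (eps j)`, i.e. `(a_j δ) ⊗ 1 = x xᶜ ((a_i δ) ⊗ 1)`, ★ `sameClass_eps_localIndexedFamilyAtV₂_iff`; = `locF`-equality of `a_i, a_j` by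
★ `sameClass_epsLine_iff_locF_apply_eq`) and `chi j = chi i` — §3 through ★ (r1) `areIsomorphicRep_localType₂_iff_quot`.  No non-vanishing hypothesis is
needed: at an isotropic `V` no `Θ_v(t)` vanishes ([MoeglinVignerasWaldspurger1987, IV.2] PROVED).  At `N = 2` this is the `(ε, χ)`-part of
[Liu2021, Lem. D.1 (4)] «only if» at an isotropic non-split place for all labels and all splittings — in particular the letter R₂ there.
[cite: Liu2021, App. D Lemma D.1 (4) (p. 126, l. 5235); §D.1 Step 3 (l. 5221)] [cite: MoeglinVignerasWaldspurger1987, Chap. 3 IV.2, IV.4]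
[cite: HarrisKudlaSweet1996, Cor. 4.4 p. 962] -/
theorem sameClass_and_chi_eq_of_areIsomorphicRep_localType₂_nonsplit_of_isIsotropic
    (hV : TV.IsSymm) (hVd : IsUnit TV.det) (hJV : JV = TV.map (algebraMap F E)) (hN : 2 ≤ N)
    {ι : Type} (aOf : ι → Fˣ) (χOf : ι → Chi F E c)
    (𝓢Of : ∀ i, LocalSplitting.FinLocalSplittings F E c N hcδ hδ hd (gram F (Equiv.prodUnique (Fin N) (Fin 1)) TV (TW F (aOf i)))
      (isSymm_gram F (Equiv.prodUnique (Fin N) (Fin 1)) hV (isSymm_TW F (aOf i)))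
      (reindex_kronecker_eq_gram_map F E (Equiv.prodUnique (Fin N) (Fin 1)) hJV (JW_eq F E (aOf i))))
    (μOf : ι → ∀ v : HeightOneSpectrum (𝓞 F), (LocalRing E v)ˣ →* ℂˣ) (hμn : ∀ i v x, ‖((μOf i v x : ℂˣ) : ℂ)‖ = 1)
    (hμc : ∀ i v, Continuous fun x => ((μOf i v x : ℂˣ) : ℂ))
    (hμF : ∀ (i : ι) (v : HeightOneSpectrum (𝓞 F)) (t : (v.adicCompletion F)ˣ),
      μOf i v (Units.map (algebraMap (v.adicCompletion F) (LocalRing E v)).toMonoidHom t) = 1 ↔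
        ∃ x : (LocalRing E v)ˣ, (x : LocalRing E v) * conjLocal E c v x = algebraMap (v.adicCompletion F) (LocalRing E v) t)
    (v : HeightOneSpectrum (𝓞 F)) (hE : IsField (LocalRing E v))
    (hiso : LemD1.IsIsotropic (localIndexedFamilyAtV₂ F E c N (Equiv.prodUnique (Fin N) (Fin 1)) JV hcδ hδ hd hV hVd hJV hN aOf χOf 𝓢Of μOf
      hμn hμc hμF v).S)
    (i j : ι)
    (hiso' : AreIsomorphicRep
      (show Representation ℂ (UnitaryGroup.localPi E c N JV v) _ from
        (TwistedCoinv.rep (localCharOfCenter F E c (JW F E (aOf j)) (JW_apply_ne_zero F E (aOf j)) (χOf j).1 v) ((𝓢Of j).omegaLoc v)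
          (commute_omegaLoc_localCenter F E c N (Equiv.prodUnique (Fin N) (Fin 1)) JV (JW F E (aOf j)) hcδ hδ hd hV (isSymm_TW F (aOf j)) hJV
            (JW_eq F E (aOf j)) (JW_apply_ne_zero F E (aOf j)) (𝓢Of j) v)).comp
          (UnitaryGroup.localLineInl E c N (Equiv.prodUnique (Fin N) (Fin 1)) JV (JW F E (aOf j)) v))
      (show Representation ℂ (UnitaryGroup.localPi E c N JV v) _ from
        (TwistedCoinv.rep (localCharOfCenter F E c (JW F E (aOf i)) (JW_apply_ne_zero F E (aOf i)) (χOf i).1 v) ((𝓢Of i).omegaLoc v)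
          (commute_omegaLoc_localCenter F E c N (Equiv.prodUnique (Fin N) (Fin 1)) JV (JW F E (aOf i)) hcδ hδ hd hV (isSymm_TW F (aOf i)) hJV
            (JW_eq F E (aOf i)) (JW_apply_ne_zero F E (aOf i)) (𝓢Of i) v)).comp
          (UnitaryGroup.localLineInl E c N (Equiv.prodUnique (Fin N) (Fin 1)) JV (JW F E (aOf i)) v))) :
    LemD1.SameClass
        ((localIndexedFamilyAtV₂ F E c N (Equiv.prodUnique (Fin N) (Fin 1)) JV hcδ hδ hd hV hVd hJV hN aOf χOf 𝓢Of μOf hμn hμc hμF v).eps i)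
        ((localIndexedFamilyAtV₂ F E c N (Equiv.prodUnique (Fin N) (Fin 1)) JV hcδ hδ hd hV hVd hJV hN aOf χOf 𝓢Of μOf hμn hμc hμF v).eps j) ∧
      (localIndexedFamilyAtV₂ F E c N (Equiv.prodUnique (Fin N) (Fin 1)) JV hcδ hδ hd hV hVd hJV hN aOf χOf 𝓢Of μOf hμn hμc hμF v).chi j =
        (localIndexedFamilyAtV₂ F E c N (Equiv.prodUnique (Fin N) (Fin 1)) JV hcδ hδ hd hV hVd hJV hN aOf χOf 𝓢Of μOf hμn hμc hμF v).chi i :=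
  sameClass_and_chi_eq_of_areIsomorphicRep_nonsplit_of_isIsotropic_prodUnique F E c N JV hcδ hδ hd hV hVd hJV hN aOf χOf 𝓢Of μOf hμn hμc
    hμF v hE hiso i j
    ((areIsomorphicRep_localType₂_iff_quot F E c N (Equiv.prodUnique (Fin N) (Fin 1)) JV hcδ hδ hd hV hVd hJV hN aOf χOf 𝓢Of μOf hμn hμc hμF
      v i j).2 hiso')

end Literature.NumberTheory.Automorphic.Liu2021.Def411WeilCarriers

end
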